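import Summits.CriticalPhenomena.PercolationContinuityZ3.Theorems.Transplant.HexShadowGluing
import Summits.CriticalPhenomena.PercolationContinuityZ3.Theorems.Transplant.HexShadowChain4
import Summits.CriticalPhenomena.PercolationContinuityZ3.Theorems.Transplant.TriFilmHexShadow
import HarnessLib

/-!
# HEXAGONAL SHADOWS XVI — eq. (12) from the Gluing Lemma at EVERY density (the degenerate `p = 1` by connectedness), and the end of the chain:
# `θ_v(p_c) = 0` for connected graphs with a hexagonal shadow, a.s. uniqueness and the hexagonal Gluing Lemma; the `(111)`-films and `𝕋 × {0..k}`

builds on p205010 (kernel theorem, internal audit signed; external expert review pending) — NOT used in this file.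
Lane `prim-bschramm`, seat `prim-bschramm-p2` (gen 32; class C1b; memo `HOME/bschramm/P2-LATTICES.md` §115–§116); helper file
(`--supports stmt-CriticalPhenomena-4575 --as helper`).
* §1 the density `p = 1` (where `P_1 = δ_{E(G)}` and the node `HexGluing` is not available): for a CONNECTED graph the conclusion of eq. (12) holds outright
  at all large admissible scales — iterate a lifted unit translation `γ` (`sh ∘ γ = sh + period•e₀`) on a fixed path from a vertex `a₀` of least shadow
  radius to `γ a₀`; the `j`-fold concatenation joins `a₀ ∈ \overline{hexBall c u_{3n}}` to `γ^j a₀ ∈ \overline{hexBall (c + 2n e₀) u_n}` inside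
  `\overline{hexBall c 4n}` once `2n = j·period ≥ 2R` (`eq12_at_one`);
* §2 **`eq12Likely4_of_hexGluing : G.Connected → Φ.HexGluing → Φ.Eq12Likely4`** (§1 and «HexShadowGluing»);
* §3 **`theta_criticalProb_eq_zero_of_hexGluing`** (connected + a.s. uniqueness + `HexGluing` ⇒ `θ_v(p_c) = 0` at every vertex),
  **`slab111OwnCriticalContinuity_of_hexGluing`** (`k ≥ 1`: the `(111)`-film of thickness `k` dies at its own critical point, modulo the hexagonal
  Gluing Lemma for its shadow ALONE), **`TriFilm.theta_criticalProb_eq_zero_of_hexGluing`** (the films `𝕋 × {0..k}`, modulo a.s. uniqueness and the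
  Gluing Lemma).  TABLE v47: rows "(111)-films, k ≥ 2" and "𝕋 × {0..k}": reduced in the tree to `HexGluing` (DST Lemma 6-hex = §2.3 of the paper).
[cite: DuminilCopinSidoraviciusTassion2016, Thm. 1, §2.1 eq. (12), Lemma 6] [cite: BenjaminiSchramm1996, Conj. 4 / Question 3]
-/

noncomputable section

namespace Summit.CriticalPhenomena.PercolationContinuityZ3.Theorems.Transplant

open MeasureTheory Literature.Probability.Percolation Literature.Probability.LatticeModels SimpleGraph Filter
open Literature.Barriers.CriticalPhenomena (BurtonKeane1989_atMostOneInfiniteCluster_holds)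
open scoped Classical Topology

namespace HexShadow

variable {V : Type} {G : SimpleGraph V} (Φ : HexShadow G)

/-! ## §1 The density `p = 1`: eq. (12) by connectedness -/

/-- The triangle inequality for `triNorm` (private copy). [folklore] -/
private theorem triNorm_add_le₁₆ (v w : Site 2) : triNorm (v + w) ≤ triNorm v + triNorm w := by
  simp only [triNorm, Pi.add_apply, max_le_iff]
  have l0 := (abs_le_triNorm v).1; have l1 := (abs_le_triNorm v).2
  have l2 : |v 0 + v 1| ≤ triNorm v := (le_max_right _ _).trans (le_max_right _ _)
  have m0 := (abs_le_triNorm w).1; have m1 := (abs_le_triNorm w).2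
  have m2 : |w 0 + w 1| ≤ triNorm w := (le_max_right _ _).trans (le_max_right _ _)
  simp only [triNorm] at l0 l1 l2 m0 m1 m2 ⊢
  rw [abs_le] at l0 l1 l2 m0 m1 m2
  refine ⟨abs_le.2 ⟨?_, ?_⟩, abs_le.2 ⟨?_, ?_⟩, abs_le.2 ⟨?_, ?_⟩⟩ <;> linarith

/-- An automorphism maps the full configuration `E(G)` to itself. [folklore] -/
theorem relabel_edgeSet_eq (α : G ≃g G) : BondConfig.relabel (sym2Equiv α.toEquiv) G.edgeSet = G.edgeSet := by
  ext e
  rw [BondConfig.mem_relabel_iff, sym2Equiv_symm]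
  exact sym2Equiv_mem_edgeSet_iff α.symm e

/-- **Transport of a sure connection along a lifted translation**: if `E(G)` joins `x` to `y` inside `\overline{hexBall z r}` and `sh ∘ γ = sh + d`, then `E(G)`
joins `γ x` to `γ y` inside `\overline{hexBall (z + d) r}`. [folklore] -/
theorem edgeSet_openConnIn_shift (γ : G ≃g G) {d : Site 2} (hγ : ∀ w, Φ.sh (γ w) = Φ.sh w + d) {z : Site 2} {r : ℕ} {x y : V}
    (h : G.edgeSet ∈ openConnIn (Φ.lift (hexBall z r)) x y) : G.edgeSet ∈ openConnIn (Φ.lift (hexBall (z + d) r)) (γ x) (γ y) := by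
  have hγg : ∀ w, Φ.sh (γ w) = Equiv.addRight d (Φ.sh w) := fun w => by rw [Equiv.coe_addRight, hγ]
  rw [← image_addRight_hexBall d z r, ← Φ.image_lift γ (Equiv.addRight d) hγg, ← relabel_edgeSet_eq γ]
  exact (relabel_mem_openConnIn_iff γ.toEquiv G.edgeSet (Φ.lift (hexBall z r)) x y).2 h

/-- **Iterating a lifted unit translation**: with `sh ∘ γ = sh + period•e₀` and `E(G)` joining `a` to `γ a` inside `\overline{hexBall c R}`, the `j`-th iterate
`γ^[j] a` lies over `sh a + (j·period)•e₀` and is joined to `a` inside `\overline{hexBall c (R + j·period)}`. [folklore] -/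
theorem iterate_shift_openConnIn (γ : G ≃g G) (hγ : ∀ w, Φ.sh (γ w) = Φ.sh w + (Φ.period : ℤ) • (Pi.single 0 1 : Site 2)) {a : V} {R : ℕ}
    (h : G.edgeSet ∈ openConnIn (Φ.lift (hexBall Φ.centre R)) a (γ a)) (j : ℕ) :
    Φ.sh (γ^[j] a) = Φ.sh a + ((j : ℤ) * Φ.period) • (Pi.single 0 1 : Site 2) ∧
      G.edgeSet ∈ openConnIn (Φ.lift (hexBall Φ.centre (R + j * Φ.period))) a (γ^[j] a) := by
  induction j with
  | zero =>
    refine ⟨by simp, ?_⟩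
    simp only [Function.iterate_zero, id_eq, zero_mul, add_zero]
    have ha : a ∈ Φ.lift (hexBall Φ.centre R) := (mem_openConnIn_iff_pathIn.1 h).left_mem
    exact mem_openConnIn_iff_pathIn.2 (PathIn.refl ha)
  | succ j ih =>
    obtain ⟨hsh, hconn⟩ := ih
    refine ⟨?_, ?_⟩
    · rw [Function.iterate_succ_apply', hγ, hsh, add_assoc, ← add_smul]; push_cast; ring_nf
    · -- transport `a ⟶ γ^[j] a` by `γ`, prepend `a ⟶ γ a`
      have h1 := Φ.edgeSet_openConnIn_shift γ hγ hconn
      rw [Function.iterate_succ_apply']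
      have hsub1 : Φ.lift (hexBall Φ.centre R) ⊆ Φ.lift (hexBall Φ.centre (R + (j + 1) * Φ.period)) :=
        Φ.lift_mono (hexBall_mono _ (by nlinarith))
      have hsub2 : Φ.lift (hexBall (Φ.centre + (Φ.period : ℤ) • (Pi.single 0 1 : Site 2)) (R + j * Φ.period)) ⊆
          Φ.lift (hexBall Φ.centre (R + (j + 1) * Φ.period)) := by
        refine Φ.lift_mono fun w hw => ?_
        rw [mem_hexBall] at hw ⊢
        have e : w - Φ.centre = (w - (Φ.centre + (Φ.period : ℤ) • Pi.single 0 1)) + (Φ.period : ℤ) • Pi.single 0 1 := by abel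
        have ht : triNorm ((Φ.period : ℤ) • (Pi.single 0 1 : Site 2)) = Φ.period := by
          have := triNorm_natMul_single Φ.period 0
          exact_mod_cast this
        rw [e]
        have := triNorm_add_le₁₆ (w - (Φ.centre + (Φ.period : ℤ) • Pi.single 0 1)) ((Φ.period : ℤ) • Pi.single 0 1)
        push_cast at hw ⊢
        nlinarith
      exact SlabCriticality.openConnIn_trans (openConnIn_mono hsub1 _ _ h) (openConnIn_mono hsub2 _ _ h1)

/-- **EQ. (12) AT `p = 1` for a connected graph** (conclusion of `Eq12Likely4` with `s = 0`, at every large admissible `n`): sure connections along the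
iterated unit translation from a vertex of least shadow radius. [cite: DuminilCopinSidoraviciusTassion2016, §2.1 eq. (12)] -/
theorem eq12_at_one [Countable V] (hG : G.Connected) {v : V} {u : ℕ → ℕ}
    (hlim : Tendsto (fun n => (bondPercolation G 1).real (Φ.uniqueConn (hexBall Φ.centre n) (hexBall Φ.centre (u n)) (hexSphere Φ.centre n))) atTop (𝓝 1))
    (ε : ℝ) (hε : 0 < ε) (N : ℕ) :
    ∃ n : ℕ, N ≤ n ∧ Φ.period ∣ n ∧ ∃ s : ℤ, -(3 * (n : ℤ)) ≤ Φ.period * s ∧ (Φ.period : ℤ) * s ≤ n ∧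
      1 - ε < (bondPercolation G 1).real (Φ.conn (hexBall Φ.centre (4 * n)) (hexBall Φ.centre (u (3 * n)))
        (hexBall (Φ.centre + (2 * (n : ℤ)) • Pi.single 0 1 + ((Φ.period : ℤ) * s) • Pi.single 1 1) (u n))) := by
  haveI : Nonempty V := ⟨v⟩
  set c := Φ.centre with hc
  have hP1 : bondPercolation G 1 = Measure.dirac G.edgeSet := by
    rw [show bondPercolation G 1 = ProbabilityTheory.setBernoulli G.edgeSet 1 from rfl, ProbabilityTheory.setBernoulli_one]
  -- eventually the inner lift is nonempty
  have hne : ∀ᶠ n in atTop, (Φ.lift (hexBall c (u n))).Nonempty := by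
    have hev := hlim.eventually (Ioi_mem_nhds (show (0 : ℝ) < 1 by norm_num))
    refine hev.mono fun n hn => ?_
    by_contra hemp
    rw [Set.not_nonempty_iff_eq_empty] at hemp
    have h0 : Φ.uniqueConn (hexBall c n) (hexBall c (u n)) (hexSphere c n) = ∅ := by
      ext ω
      simp only [uniqueConn, conn, mem_openCrossing_iff, Set.mem_setOf_eq, Set.mem_empty_iff_false, iff_false, not_and]
      intro hh
      obtain ⟨x, hx, -⟩ := hh
      rw [hemp] at hx
      exact absurd hx (Set.notMem_empty x)
    have : (0 : ℝ) < (bondPercolation G 1).real (Φ.uniqueConn (hexBall c n) (hexBall c (u n)) (hexSphere c n)) := hn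
    rw [h0, measureReal_empty] at this
    exact lt_irrefl _ this
  obtain ⟨N₁, hN₁⟩ := Filter.eventually_atTop.1 hne
  -- a vertex of least shadow radius
  set f : V → ℕ := fun a => (triNorm (Φ.sh a - c)).toNat with hf
  set a₀ : V := Function.argmin f with ha₀
  have hmin : ∀ n, N₁ ≤ n → a₀ ∈ Φ.lift (hexBall c (u n)) := by
    intro n hn
    obtain ⟨a, ha⟩ := hN₁ n hn
    rw [mem_lift, mem_hexBall] at ha ⊢
    have h1 : f a₀ ≤ f a := Function.argmin_le f a
    have h2 : (f a : ℤ) = triNorm (Φ.sh a - c) := Int.toNat_of_nonneg (triNorm_nonneg _)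
    have h3 : (f a₀ : ℤ) = triNorm (Φ.sh a₀ - c) := Int.toNat_of_nonneg (triNorm_nonneg _)
    have h4 : (f a₀ : ℤ) ≤ f a := by exact_mod_cast h1
    linarith
  -- the unit translation and a sure path from `a₀` to `γ a₀`
  obtain ⟨γ, hγ⟩ := Φ.shift (Pi.single 0 1)
  have hreach : (openGraph G.edgeSet).Reachable a₀ (γ a₀) := by
    rw [show openGraph G.edgeSet = G from SimpleGraph.fromEdgeSet_edgeSet G]
    exact hG a₀ (γ a₀)
  obtain ⟨R, hR⟩ := Filter.eventually_atTop.1 (Φ.eventually_openConnIn_of_reachable hreach)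
  have hpath := Φ.iterate_shift_openConnIn γ hγ (hR R le_rfl)
  -- the scale: `n = period * M` with `M` large
  set M : ℕ := max (max N N₁) (max R 1) with hM
  refine ⟨Φ.period * M, ?_, ⟨M, rfl⟩, 0, by rw [mul_zero, neg_nonpos]; positivity, by rw [mul_zero]; positivity, ?_⟩
  · have : 1 ≤ Φ.period := Φ.period_pos
    have : N ≤ M := (le_max_left _ _).trans (le_max_left _ _)
    nlinarith
  have hPp : 1 ≤ Φ.period := Φ.period_pos
  have hM1 : 1 ≤ M := (le_max_right _ _).trans (le_max_right _ _)
  have hMR : R ≤ M := (le_max_left _ _).trans (le_max_right _ _)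
  have hMN₁ : N₁ ≤ M := (le_max_right _ _).trans (le_max_left _ _)
  set n : ℕ := Φ.period * M with hn
  have hMn : M ≤ n := by rw [hn]; nlinarith
  -- the sure connection at `j = 2M`
  obtain ⟨hsh, hconn⟩ := hpath (2 * M)
  have hmem : G.edgeSet ∈ Φ.conn (hexBall c (4 * n)) (hexBall c (u (3 * n)))
      (hexBall (c + (2 * (n : ℤ)) • Pi.single 0 1 + ((Φ.period : ℤ) * 0) • Pi.single 1 1) (u n)) := by
    refine ⟨a₀, hmin (3 * n) (hMN₁.trans (hMn.trans (by omega))), γ^[2 * M] a₀, ?_, openConnIn_mono (Φ.lift_mono (hexBall_mono _ ?_)) _ _ hconn⟩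
    · rw [mem_lift, mem_hexBall, hsh, mul_zero, zero_smul, add_zero]
      have e : Φ.sh a₀ + (((2 * M : ℕ) : ℤ) * Φ.period) • (Pi.single 0 1 : Site 2) - (c + (2 * (n : ℤ)) • Pi.single 0 1) = Φ.sh a₀ - c := by
        rw [hn]; push_cast
        rw [show (2 : ℤ) * M * Φ.period = 2 * (Φ.period * M) by ring]
        abel
      rw [e]
      have := hmin n (hMN₁.trans hMn)
      rw [mem_lift, mem_hexBall] at this
      exact this
    · rw [hn]; nlinarith
  rw [hP1, measureReal_def, Measure.dirac_apply_of_mem hmem]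
  simp only [ENNReal.toReal_one]
  linarith

/-! ## §2 Eq. (12) at every density -/

/-- A density with `θ_v(p) > 0` is either `< 1` or equal to `1`. [folklore] -/
theorem lt_one_or_eq_one (p : unitInterval) : (p : ℝ) < 1 ∨ p = 1 := by
  rcases eq_or_lt_of_le p.2.2 with h | h
  · exact Or.inr (Subtype.ext h)
  · exact Or.inl h

/-- **`Eq12Likely4` FROM THE HEXAGONAL GLUING LEMMA** for a connected graph: `p < 1` by «HexShadowGluing» (Lemmata 4, 5, eqs. (10)–(11) and the node),
`p = 1` by connectedness (§1). [cite: DuminilCopinSidoraviciusTassion2016, §2.1 eq. (12)] -/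
theorem eq12Likely4_of_hexGluing [Countable V] (hG : G.Connected) (h6 : Φ.HexGluing) : Φ.Eq12Likely4 := by
  intro v p hθ u hu4 hlim ε hε N
  rcases lt_one_or_eq_one p with hp | hp
  · exact Φ.eq12_of_hexGluing_lt_one h6 hθ hp hu4 hlim ε hε N
  · subst hp
    exact Φ.eq12_at_one hG (v := v) hlim ε hε N

/-! ## §3 The end of the chain -/

/-- **`θ_v(p_c) = 0` FROM THE HEXAGONAL GLUING LEMMA**: a connected graph with a hexagonal shadow, a.s. uniqueness of the infinite cluster at every density
and the Gluing Lemma `HexGluing` dies at its own critical point at every vertex.  (Duminil-Copin–Sidoravicius–Tassion's Theorem 1 transplanted to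
hexagonal symmetry: eq. (1), Lemmata 4–5, eqs. (10)–(13), §2.2 and the finite-size criterion are PROVED in the tree; Lemma 6 is the hypothesis.)
[cite: DuminilCopinSidoraviciusTassion2016, Thm. 1 and §2] -/
theorem theta_criticalProb_eq_zero_of_hexGluing [Countable V] (hG : G.Connected)
    (hU : ∀ p : unitInterval, ∀ᵐ ω ∂(bondPercolation G p), numInfiniteClusters ω ≤ 1) (h6 : Φ.HexGluing) (v : V) :
    theta G v (criticalProbIOf G v) = 0 :=
  Φ.theta_criticalProb_eq_zero_of_eq12Likely4 hG hU (Φ.eq12Likely4_of_hexGluing hG h6) v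

end HexShadow

/-- **THE `(111)`-FILM THEOREM MODULO THE HEXAGONAL GLUING LEMMA**: for every thickness `k ≥ 1`, if DST's Gluing Lemma holds for the hexagonal shadow of
`F_k = {x ∈ ℤ³ : 0 ≤ x₀+x₁+x₂ ≤ k}` (`(Slab111.hexShadow k).HexGluing` — §2.3 of the paper with the film's local surgery), then
`Slab111OwnCriticalContinuity k`: the film dies at its own critical point at every vertex.  Independent of p205010.
[cite: DuminilCopinSidoraviciusTassion2016, Thm. 1, Lemma 6] [cite: BenjaminiSchramm1996, Conj. 4 / Question 3] -/
theorem slab111OwnCriticalContinuity_of_hexGluing {k : ℕ} (hk : 1 ≤ k) (h6 : (Slab111.hexShadow k).HexGluing) : Slab111OwnCriticalContinuity k :=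
  slab111OwnCriticalContinuity_of_eq12Likely4 hk ((Slab111.hexShadow k).eq12Likely4_of_hexGluing (Slab111.connected hk) h6)

/-- **THE TRIANGULAR FILMS `𝕋 × {0..k}` MODULO THE HEXAGONAL GLUING LEMMA** (and a.s. uniqueness, routine for these amenable quasi-transitive graphs):
`θ_v(p_c) = 0` at every vertex of `TriFilm.film k`. [cite: DuminilCopinSidoraviciusTassion2016, Thm. 1, Lemma 6] [cite: BenjaminiSchramm1996, Conj. 4 / Question 3] -/
theorem TriFilm.theta_criticalProb_eq_zero_of_hexGluing (k : ℕ)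
    (hU : ∀ p : unitInterval, ∀ᵐ ω ∂(bondPercolation (TriFilm.film k) p), numInfiniteClusters ω ≤ 1) (h6 : (TriFilm.hexShadow k).HexGluing)
    (v : triFilm k) : theta (TriFilm.film k) v (criticalProbIOf (TriFilm.film k) v) = 0 :=
  (TriFilm.hexShadow k).theta_criticalProb_eq_zero_of_hexGluing (TriFilm.connected k) hU h6 v

end Summit.CriticalPhenomena.PercolationContinuityZ3.Theorems.Transplant

end
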